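import Mathlib.LinearAlgebra.Dimension.Finrank
import Mathlib.LinearAlgebra.FiniteDimensional.Defs
import Mathlib.Data.Rat.Defs
import Mathlib.Tactic
import HarnessLib

/-!
# `SheafSeedGaussSq` (stmt-HodgeConjecture-30548), line `secant-q824`: the SPLIT-OBJECT CENSUS of the secant plane —
# kernel-checked model lemmas behind memo bc5g18 §3 («no direct sum of shifted line bundles is a secant witness»)

Small-model facts of the standing disprover (`cdisprove-stmt-HodgeConjecture-30548`) for the plan-only rung
`stub_rung_secantObjectsQ824` of `Cruxes/SheafSeedGaussSq/Lines/secant_q824.lean`. DICTIONARY (on paper, as in the line file's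
docstring of `GenusFourSecantDatum.endQ` and the g18 memo §3): on an abelian fourfold `B` with `NS(B)_ℚ = ℚθ` a strictly perfect
complex whose terms are sums of line bundles has, after any rational `B`-field `exp(cθ)`, twisted class
`κ = Σ_a N_a · exp(t_a θ)` with finitely many DISTINCT slopes `t_a ∈ ℚ` and signed multiplicities `N_a ∈ ℤ`; its degree-`p` part is
`M_p θᵖ/p!` with the MOMENTS `M_p = Σ_a N_a t_aᵖ`. The secant plane of `HasSecantTwistedObjectOn … d` (`secRe`, `secIm` of the line
file: `κ_p = (x·secRe d p + y·secIm d p)·θᵖ`, `x ≠ 0`) reads, in moments,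

  `M₀ = x,  M₁ = y,  M₂ = −d·M₀,  M₃ = −d·M₁,  M₄ = d²·M₀`     (`d > 0`).

What is proved here (pure algebra over `ℚ`, sorry-free; nothing about sheaves, HC, HC_AV, HC_CM, WeilSixfolds, stmt-18881 or
stmt-30548 is asserted, and STUB 1 is NOT refuted by this census — non-split objects remain):

* `secantMoments_three_slopes` — with at most THREE distinct slopes the three plane equations force `N = 0`, hence `x = M₀ = 0`:
  NO split complex with `≤ 3` slopes is a secant witness at ANY level `d > 0` (Vandermonde in `w_a = N_a (t_a² + d)`);
* `secantMoments_nonneg` — a single split SHEAF (all `N_a ≥ 0`) never lies on the plane unless `N = 0` (`M₂ ≥ 0 > −d M₀`);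
* `secantMoments_four_slopes_example` — with FOUR slopes the CLASS-level equations DO have solutions with `x ≠ 0`:
  `d = 1`, slopes `(0, 1, 2, 4)`, `N = (−255, 340, −102, 5)`, moments `(M₀,…,M₄) = (−12, 156, 12, −156, −12)`; so the class pin
  alone does not exclude split complexes and the admissibility conjunct of the rung is load-bearing;
* `momentMatrix_four_columns_dependent` — for ANY four slopes the `3 × 4` moment matrix `(t_a^q)_{q<3}` has a non-zero kernel
  vector: the model of `σ = (σ₀, σ₁, σ₂)` restricted to the scalar diagonal `⊕_a H^{0,2} ⊂ Ext²(E,E)` of a split complex with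
  `≥ 4` slopes (memo §3 (C): `σ_q` acts there by `X_a ↦ Σ_a ε_a t_a^q X_a · θ^q/q!`), hence `σ` is NOT injective on `Ext²` and such a
  complex is not `gluableSigmaAdmissible` — closing the census: split objects are never witnesses of the rung.

Exact re-computation table (149142 + 3·715 slope sets, criterion `x = 0 ⇔ Im Π_a (t_a + i√d) = 0` verified): evidence
`compute/secant_split_census.out` on stmt-HodgeConjecture-30548. Refuter `refuter-cdisprove-stmt-HodgeConjecture-30548-g0-0`, 2026-08-30.
[cite: Markman2025SecantWeil, Ex. 8.2.3 and Question 8.2.4 (the secant classes exp(√-d θ))] [cite: BuchweitzFlenner2003, Def. 4.1 (the semiregularity map σ)]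
-/

namespace Summit.HodgeConjecture.HodgeConjecture.Theorems.SheafSeedGaussSq.Negative

-- the cell's namespace repeats the summit name, as in every summit-side file of this single-problem summit
set_option linter.dupNamespace false

/-! ## §1 At most three slopes: the plane equations force `N = 0` (so `x = M₀ = 0`) -/

/-- **Three distinct slopes never reach the secant plane.** If `N₁ e^{t₁θ} + N₂ e^{t₂θ} + N₃ e^{t₃θ}` satisfies the degree-2, 3, 4
plane equations `M₂ = −d M₀`, `M₃ = −d M₁`, `M₄ = d² M₀` with `d > 0` and pairwise distinct slopes, then `N₁ = N₂ = N₃ = 0`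
(and in particular the rank `x = M₀ = N₁ + N₂ + N₃` vanishes). Proof: `w_a := N_a (t_a² + d)` has vanishing moments of orders
`0, 1, 2`, a Vandermonde system. Fewer slopes are the case `N₃ = 0` (resp. `N₂ = N₃ = 0`) at auxiliary distinct slopes. [folklore] -/
theorem secantMoments_three_slopes {d t₁ t₂ t₃ N₁ N₂ N₃ : ℚ} (hd : 0 < d) (h₁₂ : t₁ ≠ t₂) (h₁₃ : t₁ ≠ t₃) (h₂₃ : t₂ ≠ t₃)
    (e₂ : N₁ * t₁ ^ 2 + N₂ * t₂ ^ 2 + N₃ * t₃ ^ 2 = -d * (N₁ + N₂ + N₃))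
    (e₃ : N₁ * t₁ ^ 3 + N₂ * t₂ ^ 3 + N₃ * t₃ ^ 3 = -d * (N₁ * t₁ + N₂ * t₂ + N₃ * t₃))
    (e₄ : N₁ * t₁ ^ 4 + N₂ * t₂ ^ 4 + N₃ * t₃ ^ 4 = d ^ 2 * (N₁ + N₂ + N₃)) :
    N₁ = 0 ∧ N₂ = 0 ∧ N₃ = 0 := by
  have hw₁ : N₁ * ((t₁ ^ 2 + d) * ((t₁ - t₂) * (t₁ - t₃))) = 0 := by
    linear_combination e₄ + (d + t₂ * t₃) * e₂ - (t₂ + t₃) * e₃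
  have hw₂ : N₂ * ((t₂ ^ 2 + d) * ((t₂ - t₁) * (t₂ - t₃))) = 0 := by
    linear_combination e₄ + (d + t₁ * t₃) * e₂ - (t₁ + t₃) * e₃
  have hw₃ : N₃ * ((t₃ ^ 2 + d) * ((t₃ - t₁) * (t₃ - t₂))) = 0 := by
    linear_combination e₄ + (d + t₁ * t₂) * e₂ - (t₁ + t₂) * e₃
  have p₁ : (t₁ ^ 2 + d) * ((t₁ - t₂) * (t₁ - t₃)) ≠ 0 :=
    mul_ne_zero (by positivity) (mul_ne_zero (sub_ne_zero.mpr h₁₂) (sub_ne_zero.mpr h₁₃))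
  have p₂ : (t₂ ^ 2 + d) * ((t₂ - t₁) * (t₂ - t₃)) ≠ 0 :=
    mul_ne_zero (by positivity) (mul_ne_zero (sub_ne_zero.mpr (Ne.symm h₁₂)) (sub_ne_zero.mpr h₂₃))
  have p₃ : (t₃ ^ 2 + d) * ((t₃ - t₁) * (t₃ - t₂)) ≠ 0 :=
    mul_ne_zero (by positivity) (mul_ne_zero (sub_ne_zero.mpr (Ne.symm h₁₃)) (sub_ne_zero.mpr (Ne.symm h₂₃)))
  exact ⟨(mul_eq_zero.mp hw₁).resolve_right p₁, (mul_eq_zero.mp hw₂).resolve_right p₂,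
    (mul_eq_zero.mp hw₃).resolve_right p₃⟩

/-- Corollary: with at most three slopes the rank `x = M₀` of a class on the secant plane is `0` — no secant witness
(`HasSecantTwistedObjectOn` demands `x ≠ 0`). [folklore] -/
theorem secantMoments_three_slopes_rank_zero {d t₁ t₂ t₃ N₁ N₂ N₃ : ℚ} (hd : 0 < d) (h₁₂ : t₁ ≠ t₂) (h₁₃ : t₁ ≠ t₃)
    (h₂₃ : t₂ ≠ t₃)
    (e₂ : N₁ * t₁ ^ 2 + N₂ * t₂ ^ 2 + N₃ * t₃ ^ 2 = -d * (N₁ + N₂ + N₃))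
    (e₃ : N₁ * t₁ ^ 3 + N₂ * t₂ ^ 3 + N₃ * t₃ ^ 3 = -d * (N₁ * t₁ + N₂ * t₂ + N₃ * t₃))
    (e₄ : N₁ * t₁ ^ 4 + N₂ * t₂ ^ 4 + N₃ * t₃ ^ 4 = d ^ 2 * (N₁ + N₂ + N₃)) :
    N₁ + N₂ + N₃ = 0 := by
  obtain ⟨rfl, rfl, rfl⟩ := secantMoments_three_slopes hd h₁₂ h₁₃ h₂₃ e₂ e₃ e₄
  simp

/-! ## §2 A single split sheaf (non-negative multiplicities) never lies on the plane -/

/-- **Non-negative multiplicities force `N = 0` on the plane** (already from the degree-2 equation `M₂ = −d M₀`, any number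
`k` of slopes): `Σ N_a t_a² ≥ 0 ≥ −d Σ N_a`. A direct sum of line bundles placed in ONE degree is never a secant witness.
[folklore] -/
theorem secantMoments_nonneg {k : ℕ} {d : ℚ} (hd : 0 < d) (t N : Fin k → ℚ) (hN : ∀ a, 0 ≤ N a)
    (e₂ : ∑ a, N a * t a ^ 2 = -d * ∑ a, N a) : ∀ a, N a = 0 := by
  have h0 : 0 ≤ ∑ a, N a * t a ^ 2 := Finset.sum_nonneg fun a _ => mul_nonneg (hN a) (sq_nonneg _)
  have h1 : 0 ≤ ∑ a, N a := Finset.sum_nonneg fun a _ => hN a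
  have hsum : ∑ a, N a = 0 := by nlinarith
  intro a
  exact (Finset.sum_eq_zero_iff_of_nonneg fun b _ => hN b).mp hsum a (Finset.mem_univ a)

/-! ## §3 Four slopes: the CLASS-level equations have solutions with `x ≠ 0` -/

/-- **An explicit class-level split solution with four slopes** (`d = 1`, slopes `0, 1, 2, 4`, multiplicities
`−255, 340, −102, 5`): all five plane equations hold with `(x, y) = (−12, 156)`, `x ≠ 0`. Hence the cohomological pin of the
rung does not by itself exclude split complexes; only the admissibility conjunct (`σ` injective, §4) does. [folklore] -/
theorem secantMoments_four_slopes_example :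
    let t : Fin 4 → ℚ := ![0, 1, 2, 4]
    let N : Fin 4 → ℚ := ![-255, 340, -102, 5]
    let d : ℚ := 1
    Function.Injective t ∧ (∑ a, N a) ≠ 0 ∧
      (∑ a, N a) = -12 ∧ (∑ a, N a * t a) = 156 ∧
      (∑ a, N a * t a ^ 2) = -d * ∑ a, N a ∧
      (∑ a, N a * t a ^ 3) = -d * ∑ a, N a * t a ∧
      (∑ a, N a * t a ^ 4) = d ^ 2 * ∑ a, N a := by
  refine ⟨?_, ?_, ?_, ?_, ?_, ?_, ?_⟩
  · intro a b h
    fin_cases a <;> fin_cases b <;> simp_all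
  all_goals simp [Fin.sum_univ_four]; try norm_num

/-! ## §4 Four or more slopes: `σ` restricted to the scalar diagonal has a kernel -/

/-- **Four moment columns in `ℚ³` are dependent**: for any slopes `t : Fin 4 → ℚ` there is `c ≠ 0` with
`Σ_a c_a t_a^q = 0` for `q = 0, 1, 2` — the model of `(σ₀, σ₁, σ₂)` on the scalar diagonal `⊕_{a<4} H^{0,2}·id` of
`Ext²(E, E)` for a split complex with four slopes (signs `ε_a = ±1` rescale the columns and do not change this). So `σ`
is not injective on `Ext²` and the complex is not `gluableSigmaAdmissible`. [folklore] -/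
theorem momentMatrix_four_columns_dependent (t : Fin 4 → ℚ) :
    ∃ c : Fin 4 → ℚ, c ≠ 0 ∧ ∀ q : Fin 3, ∑ a, c a * t a ^ (q : ℕ) = 0 := by
  -- the four vectors `v a = (t a ^ q)_{q < 3}` in `ℚ³` cannot be linearly independent
  let v : Fin 4 → (Fin 3 → ℚ) := fun a q => t a ^ (q : ℕ)
  have hv : ¬ LinearIndependent ℚ v := by
    intro h
    have := h.fintype_card_le_finrank
    simp at this
  obtain ⟨c, hc0, a, ha⟩ := Fintype.not_linearIndependent_iff.mp hv
  refine ⟨c, fun h => ha (by simp [h]), fun q => ?_⟩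
  have := congrFun hc0 q
  simpa [v, Finset.sum_apply, Pi.smul_apply, smul_eq_mul] using this

end Summit.HodgeConjecture.HodgeConjecture.Theorems.SheafSeedGaussSq.Negative
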